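import Summits.AtomisticToContinuum.Crystallization.Theorems.ChargedEnergyGapChamberCert
import Summits.AtomisticToContinuum.Crystallization.Theorems.ChargedEnergyGapFarkasBox
import HarnessLib

/-!
# ChargedEnergyGap · NODE 113B «DietStation» — the chamber station checker on SHORT data: diet weight rows + box-absorbed certificates (MU-DIET)

decomp-a2c lens-3 g93.  Imports tree NODE 112 «ChamberCert» (`chamberRows`, `checkCh`'s blocks, `capCheck_zero_chamber`, `payload_sound`, `box_payload_sound`)
and lane NODE 113A «FarkasBox» (`Bsp.checkBox`, `Bsp.sound_box`); memo MUDIET-SPEC-g93 §2.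

WHY (critic r1670/r1675; target: station file ≤ 90 KB ∧ ≤ 15 s ∧ ≤ 400 lines).  A g92 station literal weighs 372 KB, 83–94 % of it EXACT Farkas
multipliers (dual vertices of rows carrying exact values of the degree-28 `φ`: the six `wChordRow`s with ≈ 165-digit denominators).  MU-DIET:
(1) DIET ROWS — the affine weight rows are SHORT DATA `(q, m, c₀, anchor)` validated ONCE per station against exact `depthProfileQ` by two endpoint
    comparisons each: an upper row `W_q − m·x_q ≤ c₀` holds on the slot box iff it holds at both ends (`φ` convex, N97 `depthProfile_chord_upper`); a
    lower row `m·x_q − W_q ≤ c₀` holds if it lies below the LEFT secant anchored at `a′ < lo_q` (N97 `depthProfile_secant_lower`) or the RIGHT secant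
    anchored at `b′ > hi_q` (`depthProfile_secant_lower_right`, here);
(2) BOX ABSORPTION — the tree is checked with 113A `Bsp.checkBox` against the twenty coordinate bounds `StationRowsCert.bnd`, so multipliers are short
    decimals and the residual form is charged to the bounds; (3) cone bases are inverse-checked lazily per cone leaf (`needD`).
The exact 110D rows stay in the pool (`R.rows`, indices unchanged), followed by the five chamber rows (chamber form) and the diet rows.
Contents: `affine_nonneg_on`, `chord_le_affine`, `secant_lower_right`, `depthProfile_secant_lower_right`; `WLine`, `wUpRow`, `wLoRow`,
`StationRowsCert.upOk / loLOk / loROk` (+ `_sound`), `DietCert` (`rows`, `ok`, ★ `rows_sound`); `StationRowsCert.bnd` + ★ `bnd_sound`; `StationCert.needD`,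
`checkD` (chamber form, for 112) / `checkDF` (full form, for 110E); ★★ `sound_leaf` (the leaf dispatch of 110E/112 ONCE, generic in the cap predicate);
★★★ `sound_diet` — EXACTLY the statement of 112 `sound_chamber` with `checkD c X` for `checkCh c`; ★★★ `sound_dietF` — EXACTLY 110E `sound` with
`checkDF c X`; batch form `sound_diet_of_all` (chamber; the shape door D4 consumes).
[SPLIT beneath (T¹ᶜ) ∘ NODE 111 (no EQUIV introduced) · UNDECIDED(test = (D¹)) unchanged.] -/

namespace Summit.AtomisticToContinuum.Crystallization.Theorems.ChargedEnergyGapChartDial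

/-! ## §113B.1 Two-endpoint principles -/

/-- An affine function non-negative at both ends of `[lo, hi]` (`lo < hi`) is non-negative on it. -/
theorem affine_nonneg_on {lo hi d u v : ℝ} (hlt : lo < hi) (h1 : 0 ≤ u + v * lo) (h2 : 0 ≤ u + v * hi) (hlo : lo ≤ d) (hhi : d ≤ hi) :
    0 ≤ u + v * d := by
  have key : (hi - lo) * (u + v * d) = (d - lo) * (u + v * hi) + (hi - d) * (u + v * lo) := by ring
  have h : 0 ≤ (hi - lo) * (u + v * d) := by
    rw [key]; exact add_nonneg (mul_nonneg (sub_nonneg.2 hlo) h2) (mul_nonneg (sub_nonneg.2 hhi) h1)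
  nlinarith [h, sub_pos.2 hlt]

/-- The chord of `f` over `[lo, hi]` lies below an affine function `c₀ + m·d` on `[lo, hi]` as soon as it does at the two ends. -/
theorem chord_le_affine {lo hi flo fhi m c0 d : ℝ} (hlt : lo < hi) (h1 : flo ≤ c0 + m * lo) (h2 : fhi ≤ c0 + m * hi) (hlo : lo ≤ d) (hhi : d ≤ hi) :
    flo + (fhi - flo) / (hi - lo) * (d - lo) ≤ c0 + m * d := by
  have hhl : 0 < hi - lo := sub_pos.2 hlt
  have key : (fhi - flo) / (hi - lo) * (d - lo) ≤ c0 + m * d - flo := by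
    rw [div_mul_eq_mul_div, div_le_iff₀ hhl]
    nlinarith [mul_le_mul_of_nonneg_right h1 (sub_nonneg.2 hhi), mul_le_mul_of_nonneg_right h2 (sub_nonneg.2 hlo)]
  linarith

/-- ★ RIGHT SECANT-EXTENSION LOWER BOUND: for `f` convex on `s`, `d ≤ hi < b` with `d, b ∈ s`:
`f hi + (f b − f hi)/(b − hi) · (d − hi) ≤ f d` (the secant through `hi, b` extended to the left of `hi` minorises `f`; mirror of N97 `secant_lower`). -/
theorem secant_lower_right {s : Set ℝ} {f : ℝ → ℝ} (hf : ConvexOn ℝ s f) {d hi b : ℝ} (hd : d ∈ s) (hb : b ∈ s) (hdhi : d ≤ hi) (hhib : hi < b) :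
    f hi + (f b - f hi) / (b - hi) * (d - hi) ≤ f d := by
  rcases eq_or_lt_of_le hdhi with rfl | hlt
  · simp
  · have hbd : 0 < b - d := by linarith
    have hbh : 0 < b - hi := sub_pos.2 hhib
    -- convexity at `hi` between `d` and `b`
    have hch := chord_upper hf hd hb (hlt.trans hhib) hlt.le hhib.le
    rw [← sub_le_iff_le_add', div_mul_eq_mul_div, le_div_iff₀ hbd] at hch
    have key : (f b - f hi) / (b - hi) * (d - hi) ≤ f d - f hi := by
      rw [div_mul_eq_mul_div, div_le_iff₀ hbh]
      linarith
    linarith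

/-- ★ «env2» RIGHT LOWER ROW for `φ`: the secant of `φ = depthProfile 160` through `hi < b` (`b ≤ 134`) minorises `φ` on `[lo, hi]` (`80 ≤ lo`). -/
theorem depthProfile_secant_lower_right {lo hi b : ℝ} (hlo : 80 ≤ lo) (hhib : hi < b) (hb : b ≤ 134) :
    ∀ d, lo ≤ d → d ≤ hi →
      depthProfile 160 hi + (depthProfile 160 b - depthProfile 160 hi) / (b - hi) * (d - hi) ≤ depthProfile 160 d :=
  fun _ h1 h2 => secant_lower_right depthProfile_convexOn ⟨by linarith, by linarith⟩ ⟨by linarith, hb⟩ h2 hhib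

/-! ## §113B.2 The diet weight rows -/

/-- ONE DIET WEIGHT LINE (short data): slot `q`, slope `m`, offset `c0`, and an anchor `t` (the secant anchor of a lower row; ignored for upper rows). -/
structure WLine where
  /-- the slot -/
  q : Fin 3 × Bool
  /-- slope -/
  m : ℚ
  /-- offset (right-hand side of the row) -/
  c0 : ℚ
  /-- secant anchor (`a′ < lo q` for a left lower row, `b′ > hi q` for a right lower row; unused for upper rows) -/
  t : ℚ

/-- The UPPER row `W_q − m·x_q ≤ c0`. -/
def wUpRow (l : WLine) : LRow := ⟨axpy 1 (unitRow (13 + slotIx l.q) 1) (unitRow (slotIx l.q) (-l.m)), l.c0⟩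

/-- The LOWER row `m·x_q − W_q ≤ c0`. -/
def wLoRow (l : WLine) : LRow := ⟨axpy l.m (unitRow (slotIx l.q) 1) (unitRow (13 + slotIx l.q) (-1)), l.c0⟩

/-- `wUpRow` at the valuation. -/
theorem linAt_wUpRow (l : WLine) (dt : (Fin 3 → ℤ) → ℝ) :
    linAt (wUpRow l).a (sval dt) 0 = depthProfile 160 (dt (stPt (some l.q))) - (l.m : ℝ) * dt (stPt (some l.q)) := by
  simp only [wUpRow, linAt_axpy, linAt_unitRow, sval_w]; rw [show slotIx l.q = ptIx (some l.q) from rfl, sval_pt]; push_cast; ring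

/-- `wLoRow` at the valuation. -/
theorem linAt_wLoRow (l : WLine) (dt : (Fin 3 → ℤ) → ℝ) :
    linAt (wLoRow l).a (sval dt) 0 = (l.m : ℝ) * dt (stPt (some l.q)) - depthProfile 160 (dt (stPt (some l.q))) := by
  simp only [wLoRow, linAt_axpy, linAt_unitRow, sval_w]; rw [show slotIx l.q = ptIx (some l.q) from rfl, sval_pt]; push_cast; ring

/-- Validation of an UPPER row on the slot box: it holds at both ends (exact `depthProfileQ`). -/
def StationRowsCert.upOk (c : StationRowsCert) (l : WLine) : Bool :=
  decide (depthProfileQ 160 (c.lo l.q) ≤ l.c0 + l.m * c.lo l.q ∧ depthProfileQ 160 (c.hi l.q) ≤ l.c0 + l.m * c.hi l.q)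

/-- Validation of a LEFT lower row: anchor `80 ≤ a′ < lo`, and the row lies below the left secant at both ends of the slot box. -/
def StationRowsCert.loLOk (c : StationRowsCert) (l : WLine) : Bool :=
  decide (80 ≤ l.t ∧ l.t < c.lo l.q ∧ l.m * c.lo l.q - l.c0 ≤ depthProfileQ 160 (c.lo l.q) ∧
    l.m * c.hi l.q - l.c0 ≤ depthProfileQ 160 l.t + phiSlope l.t (c.lo l.q) * (c.hi l.q - l.t))

/-- Validation of a RIGHT lower row: anchor `hi < b′ ≤ 134`, and the row lies below the right secant at both ends of the slot box. -/
def StationRowsCert.loROk (c : StationRowsCert) (l : WLine) : Bool :=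
  decide (c.hi l.q < l.t ∧ l.t ≤ 134 ∧ l.m * c.hi l.q - l.c0 ≤ depthProfileQ 160 (c.hi l.q) ∧
    l.m * c.lo l.q - l.c0 ≤ depthProfileQ 160 (c.hi l.q) + phiSlope (c.hi l.q) l.t * (c.lo l.q - c.hi l.q))

variable {c : StationRowsCert} {dt : (Fin 3 → ℤ) → ℝ}

/-- ★ Upper-row soundness (N97 chord + `chord_le_affine`). -/
theorem StationRowsCert.upOk_sound (l : WLine) (h : c.upOk l = true) (hlo : 80 ≤ c.lo l.q) (hlt : c.lo l.q < c.hi l.q) (hhi : c.hi l.q ≤ 134)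
    (hq : (c.lo l.q : ℝ) ≤ dt (stPt (some l.q)) ∧ dt (stPt (some l.q)) ≤ c.hi l.q) : linAt (wUpRow l).a (sval dt) 0 ≤ ((wUpRow l).b : ℝ) := by
  simp only [StationRowsCert.upOk, decide_eq_true_eq] at h
  have h1 := qle h.1; have h2 := qle h.2
  rw [cast_depthProfileQ160] at h1 h2
  push_cast at h1 h2
  rw [linAt_wUpRow]
  have hch := depthProfile_chord_upper (lo := (c.lo l.q : ℝ)) (hi := (c.hi l.q : ℝ)) (by exact_mod_cast hlo) (by exact_mod_cast hhi)
    (by exact_mod_cast hlt) _ hq.1 hq.2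
  have haff := chord_le_affine (flo := depthProfile 160 (c.lo l.q : ℝ)) (fhi := depthProfile 160 (c.hi l.q : ℝ)) (m := (l.m : ℝ)) (c0 := (l.c0 : ℝ))
    (by exact_mod_cast hlt) h1 h2 hq.1 hq.2
  change _ ≤ ((l.c0 : ℚ) : ℝ)
  linarith

/-- ★ Left-lower-row soundness (N97 left secant + `affine_nonneg_on`). -/
theorem StationRowsCert.loLOk_sound (l : WLine) (h : c.loLOk l = true) (hlt : c.lo l.q < c.hi l.q) (hhi : c.hi l.q ≤ 134)
    (hq : (c.lo l.q : ℝ) ≤ dt (stPt (some l.q)) ∧ dt (stPt (some l.q)) ≤ c.hi l.q) : linAt (wLoRow l).a (sval dt) 0 ≤ ((wLoRow l).b : ℝ) := by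
  simp only [StationRowsCert.loLOk, decide_eq_true_eq] at h
  obtain ⟨ha, halo, h1, h2⟩ := h
  have h1 := qle h1; have h2 := qle h2
  rw [cast_depthProfileQ160] at h1
  push_cast at h1 h2
  simp only [cast_phiSlope, cast_depthProfileQ160] at h2
  rw [linAt_wLoRow]
  set d := dt (stPt (some l.q)) with hd
  have hsec := depthProfile_secant_lower (a := (l.t : ℝ)) (lo := (c.lo l.q : ℝ)) (hi := (c.hi l.q : ℝ)) (by exact_mod_cast ha)
    (by exact_mod_cast halo) (by exact_mod_cast hhi) d hq.1 hq.2
  -- the row lies below the secant: affine comparison at the two ends of the slot box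
  set S := (depthProfile 160 (c.lo l.q : ℝ) - depthProfile 160 (l.t : ℝ)) / ((c.lo l.q : ℝ) - l.t) with hS
  have hSlo : depthProfile 160 (l.t : ℝ) + S * ((c.lo l.q : ℝ) - l.t) = depthProfile 160 (c.lo l.q : ℝ) := by
    have hlt' : (l.t : ℝ) < c.lo l.q := by exact_mod_cast halo
    rw [hS, div_mul_cancel₀ _ (sub_ne_zero.2 (ne_of_gt hlt'))]; ring
  have haff := affine_nonneg_on (u := depthProfile 160 (l.t : ℝ) - S * (l.t : ℝ) + l.c0) (v := S - l.m) (by exact_mod_cast hlt)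
    (by linarith) (by linarith) hq.1 hq.2
  change _ ≤ ((l.c0 : ℚ) : ℝ)
  linarith

/-- ★ Right-lower-row soundness (`depthProfile_secant_lower_right` + `affine_nonneg_on`). -/
theorem StationRowsCert.loROk_sound (l : WLine) (h : c.loROk l = true) (hlo : 80 ≤ c.lo l.q) (hlt : c.lo l.q < c.hi l.q)
    (hq : (c.lo l.q : ℝ) ≤ dt (stPt (some l.q)) ∧ dt (stPt (some l.q)) ≤ c.hi l.q) : linAt (wLoRow l).a (sval dt) 0 ≤ ((wLoRow l).b : ℝ) := by
  simp only [StationRowsCert.loROk, decide_eq_true_eq] at h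
  obtain ⟨hhib, hb, h1, h2⟩ := h
  have h1 := qle h1; have h2 := qle h2
  rw [cast_depthProfileQ160] at h1
  push_cast at h1 h2
  simp only [cast_phiSlope, cast_depthProfileQ160] at h2
  rw [linAt_wLoRow]
  set d := dt (stPt (some l.q)) with hd
  have hsec := depthProfile_secant_lower_right (lo := (c.lo l.q : ℝ)) (hi := (c.hi l.q : ℝ)) (b := (l.t : ℝ)) (by exact_mod_cast hlo)
    (by exact_mod_cast hhib) (by exact_mod_cast hb) d hq.1 hq.2
  set S := (depthProfile 160 (l.t : ℝ) - depthProfile 160 (c.hi l.q : ℝ)) / ((l.t : ℝ) - c.hi l.q) with hS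
  have haff := affine_nonneg_on (u := depthProfile 160 (c.hi l.q : ℝ) - S * (c.hi l.q : ℝ) + l.c0) (v := S - l.m) (by exact_mod_cast hlt)
    (by linarith) (by linarith) hq.1 hq.2
  change _ ≤ ((l.c0 : ℚ) : ℝ)
  linarith

/-- ★ THE DIET CERTIFICATE: upper rows, left-anchored lower rows, right-anchored lower rows (all short data). -/
structure DietCert where
  /-- upper rows `W_q − m·x_q ≤ c0` -/
  up : List WLine
  /-- lower rows `m·x_q − W_q ≤ c0` certified by a left secant (`t = a′ < lo q`) -/
  loL : List WLine
  /-- lower rows `m·x_q − W_q ≤ c0` certified by a right secant (`t = b′ > hi q`) -/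
  loR : List WLine

/-- The diet rows, in pool order: upper, left lower, right lower. -/
def DietCert.rows (X : DietCert) : List LRow := X.up.map wUpRow ++ X.loL.map wLoRow ++ X.loR.map wLoRow

/-- The diet validation against the station box. -/
def DietCert.ok (X : DietCert) (c : StationRowsCert) : Bool := X.up.all c.upOk && X.loL.all c.loLOk && X.loR.all c.loROk

/-- ★ SOUNDNESS OF THE DIET ROWS: validated rows hold at the valuation of every tuple in the station box. -/
theorem DietCert.rows_sound (X : DietCert) (hX : X.ok c = true) (hsl : ∀ q, 80 ≤ c.lo q ∧ c.lo q < c.hi q ∧ c.hi q ≤ 134)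
    (h7 : ∀ o, (c.lo7 o : ℝ) ≤ dt (stPt o) ∧ dt (stPt o) ≤ c.hi7 o) : ∀ r ∈ X.rows, linAt r.a (sval dt) 0 ≤ (r.b : ℝ) := by
  simp only [DietCert.ok, Bool.and_eq_true, List.all_eq_true] at hX
  obtain ⟨⟨hup, hloL⟩, hloR⟩ := hX
  intro r hr
  simp only [DietCert.rows, List.mem_append, List.mem_map] at hr
  rcases hr with (⟨l, hl, rfl⟩ | ⟨l, hl, rfl⟩) | ⟨l, hl, rfl⟩
  · obtain ⟨hlo, hlt, hhi⟩ := hsl l.q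
    exact c.upOk_sound l (hup l hl) hlo hlt hhi (h7 (some l.q))
  · obtain ⟨_, hlt, hhi⟩ := hsl l.q
    exact c.loLOk_sound l (hloL l hl) hlt hhi (h7 (some l.q))
  · obtain ⟨hlo, hlt, _⟩ := hsl l.q
    exact c.loROk_sound l (hloR l hl) hlo hlt (h7 (some l.q))

/-! ## §113B.3 The coordinate bounds of a station -/

/-- ★ THE TWENTY COORDINATE BOUNDS of the valuation `sval` on a station: depths `0..6` in the box (centre, 0T, 0F, 1T, 1F, 2T, 2F), squares `7..13` in the
squared box (valid as `0 ≤ lo`), weights `14..19` in `[0, 1]`. -/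
def StationRowsCert.bnd (c : StationRowsCert) : List (ℚ × ℚ) :=
  [(c.loC, c.hiC), (c.lo (0, true), c.hi (0, true)), (c.lo (0, false), c.hi (0, false)), (c.lo (1, true), c.hi (1, true)),
    (c.lo (1, false), c.hi (1, false)), (c.lo (2, true), c.hi (2, true)), (c.lo (2, false), c.hi (2, false)),
    (c.loC ^ 2, c.hiC ^ 2), (c.lo (0, true) ^ 2, c.hi (0, true) ^ 2), (c.lo (0, false) ^ 2, c.hi (0, false) ^ 2),
    (c.lo (1, true) ^ 2, c.hi (1, true) ^ 2), (c.lo (1, false) ^ 2, c.hi (1, false) ^ 2), (c.lo (2, true) ^ 2, c.hi (2, true) ^ 2),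
    (c.lo (2, false) ^ 2, c.hi (2, false) ^ 2), (0, 1), (0, 1), (0, 1), (0, 1), (0, 1), (0, 1)]

/-- ★ The valuation of a tuple in the station box meets the twenty bounds (`0 ≤ lo` for the squares; `0 ≤ φ ≤ 1` for the weights). -/
theorem StationRowsCert.bnd_sound (c : StationRowsCert) (h7 : ∀ o, (c.lo7 o : ℝ) ≤ dt (stPt o) ∧ dt (stPt o) ≤ c.hi7 o) (hnn : ∀ o, 0 ≤ c.lo7 o) :
    ∀ k, k < c.bnd.length → (((c.bnd.getD k (0, 0)).1 : ℚ) : ℝ) ≤ sval dt k ∧ sval dt k ≤ (((c.bnd.getD k (0, 0)).2 : ℚ) : ℝ) := by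
  have hsq : ∀ o, (((c.lo7 o ^ 2 : ℚ)) : ℝ) ≤ dt (stPt o) ^ 2 ∧ dt (stPt o) ^ 2 ≤ (((c.hi7 o ^ 2 : ℚ)) : ℝ) := fun o => by
    obtain ⟨h1, h2⟩ := h7 o
    have h0 : (0 : ℝ) ≤ c.lo7 o := by exact_mod_cast hnn o
    push_cast
    exact ⟨pow_le_pow_left₀ h0 h1 2, pow_le_pow_left₀ (h0.trans h1) h2 2⟩
  have hw : ∀ q, (((0 : ℚ)) : ℝ) ≤ vtxW 160 dt 0 q ∧ vtxW 160 dt 0 q ≤ (((1 : ℚ)) : ℝ) := fun q => by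
    push_cast; exact ⟨vtxW_nonneg _ _ _ _, depthProfile_le_one _ _⟩
  have hC := h7 none; have h0T := h7 (some (0, true)); have h0F := h7 (some (0, false)); have h1T := h7 (some (1, true))
  have h1F := h7 (some (1, false)); have h2T := h7 (some (2, true)); have h2F := h7 (some (2, false))
  have sC := hsq none; have s0T := hsq (some (0, true)); have s0F := hsq (some (0, false)); have s1T := hsq (some (1, true))
  have s1F := hsq (some (1, false)); have s2T := hsq (some (2, true)); have s2F := hsq (some (2, false))
  simp only [StationRowsCert.lo7, StationRowsCert.hi7, stPt] at hC h0T h0F h1T h1F h2T h2F sC s0T s0F s1T s1F s2T s2F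
  intro k hk
  simp only [StationRowsCert.bnd, List.length_cons, List.length_nil] at hk
  simp only [StationRowsCert.bnd]
  interval_cases k <;> simp only [List.getD_cons_zero, List.getD_cons_succ, sval, stPt]
  exacts [hC, h0T, h0F, h1T, h1F, h2T, h2F, sC, s0T, s0F, s1T, s1F, s2T, s2F, hw _, hw _, hw _, hw _, hw _, hw _]

/-! ## §113B.4 The diet checkers and their soundness -/

/-- The `need` function of the DIET tree: 110E `need`, except that a CONE leaf's basis is inverse-checked HERE, lazily (a failing `invCheck` yields the
impossible row) — bases used only at box corners are already certified by the corners' own reconstruction (108C `cornerCheck`) and are no longer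
inverse-checked globally (kernel economy: `invCheck` is 216 rational products per basis). -/
def StationCert.needD (c : StationCert) : Leaf → List LRow
  | .cone j =>
    match c.bases[j]? with
    | none => [⟨[], -1⟩]
    | some B => if B.invCheck then c.needB B else [⟨[], -1⟩]
  | .box j =>
    match c.boxes[j]? with
    | none => [⟨[], -1⟩]
    | some b => b.need
  | .coneL j k =>
    match c.bases[j]?, c.caps[k]? with
    | some B, some l => if B.invCheck then c.needB B l.capLB ++ l.need else [⟨[], -1⟩]
    | _, _ => [⟨[], -1⟩]
  | .boxL j k =>
    match c.boxes[j]?, c.caps[k]? with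
    | some b, some l => (b.need ++ l.need) ++ [⟨[], l.capLB * c.u - c.kfac * b.R⟩]
    | _, _ => [⟨[], -1⟩]

/-- ★★★ **THE DIET CHECKER, CHAMBER FORM** (for 112 `checkCh`): its blocks (box blocks, local cap blocks, axis-0 cap block), `0 ≤ loC`, the diet validation,
and the BOX-ABSORBED tree check (cone bases inverse-checked per leaf) over the pool `R.rows ++ chamberRows ++ X.rows` against the bounds `R.bnd`. -/
def StationCert.checkD (c : StationCert) (X : DietCert) : Bool :=
  c.R.ok && decide (0 < c.R.rho0 ∧ 0 ≤ c.R.loC) && c.boxes.all c.boxCheck &&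
    c.caps.all (fun l => (c.capCertL l).capCheck 0) && c.capCert.capCheck 0 && X.ok c.R &&
    c.tree.checkBox c.needD c.R.bnd (c.R.rows ++ chamberRows ++ X.rows)

/-- ★★★ **THE DIET CHECKER, FULL FORM** (for 110E `check`: three cap blocks, no chamber rows): pool `R.rows ++ X.rows`. -/
def StationCert.checkDF (c : StationCert) (X : DietCert) : Bool :=
  c.R.ok && decide (0 < c.R.rho0 ∧ 0 ≤ c.R.loC) && c.boxes.all c.boxCheck && c.caps.all c.capCheckL &&
    c.capCert.capCheck 0 && c.capCert.capCheck 1 && c.capCert.capCheck 2 && X.ok c.R && c.tree.checkBox c.needD c.R.bnd (c.R.rows ++ X.rows)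

/-- ★★ THE LEAF DISPATCH OF 110E/112, ONCE, generic in the cap-block predicate `CAPOK` and its finishing bound `hfin`: if the blocks check and SOME payload's
needed rows hold at `sval dt`, the (T¹ᶜ) inequality holds at the tuple. -/
theorem StationCert.sound_leaf (c : StationCert) (CAPOK : CostCellCert → Prop)
    (hboxes : ∀ b ∈ c.boxes, c.boxCheck b = true) (hcaps : ∀ l ∈ c.caps, CAPOK (c.capCertL l)) (hc : CAPOK c.capCert)
    {ρ : ℝ} (hρ : 0 < ρ) (h₁ : ρ ≤ c.R.rho1) {dt : (Fin 3 → ℤ) → ℝ} (hbox : ∀ q, castW c.R.lo q ≤ dt (holeVertex 0 q) ∧ dt (holeVertex 0 q) ≤ castW c.R.hi q)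
    (hfin : ∀ k : CostCellCert, k.rho0 = c.R.rho0 → k.rho1 = c.R.rho1 → k.u = c.u → CAPOK k →
      (∀ q, castW k.lo q ≤ dt (holeVertex 0 q) ∧ dt (holeVertex 0 q) ≤ castW k.hi q) → (k.capLB : ℝ) * c.u ≤ domCapK c.u 160 (3 / 100) ρ (chargeDepth ρ dt 0))
    {π : Leaf} (hπ : ∀ r ∈ c.needD π, linAt r.a (sval dt) 0 ≤ (r.b : ℝ)) :
    feetHoleCost 160 (3 / 100) ρ dt 0 ≤ domCapK c.u 160 (3 / 100) ρ (chargeDepth ρ dt 0) := by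
  have hcost := feetHoleCost_le_of_roofVal_le (ϱ := 160) (d := dt) (w := 0) (show (0 : ℝ) ≤ 3 / 100 by norm_num) hρ.le h₁ le_rfl
  have finish : ∀ (k : CostCellCert), k.rho0 = c.R.rho0 → k.rho1 = c.R.rho1 → k.u = c.u → CAPOK k →
      (∀ q, castW k.lo q ≤ dt (holeVertex 0 q) ∧ dt (holeVertex 0 q) ≤ castW k.hi q) →
      (3 / 100 * (2 * (c.R.rho1 : ℝ))) ^ 2 * roofVal T75 (vtxW 160 dt 0) ≤ (k.capLB : ℝ) * c.u →
      feetHoleCost 160 (3 / 100) ρ dt 0 ≤ domCapK c.u 160 (3 / 100) ρ (chargeDepth ρ dt 0) :=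
    fun k e0 e1 eu k0 hb hpay => hcost.trans (hpay.trans (hfin k e0 e1 eu k0 hb))
  cases π with
  | cone j =>
    simp only [StationCert.needD] at hπ
    split at hπ
    · exact absurd hπ (not_nilRow _)
    · split at hπ
      · next hB => exact finish c.capCert rfl rfl rfl hc hbox (c.payload_sound hB dt hπ)
      · exact absurd hπ (not_nilRow _)
  | box j =>
    simp only [StationCert.needD] at hπ
    split at hπ
    · exact absurd hπ (not_nilRow _)
    · next b hb =>
      obtain ⟨hbc, hv⟩ := Bool.and_eq_true_iff.1 (hboxes b (List.mem_of_getElem? hb))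
      exact finish c.capCert rfl rfl rfl hc hbox (c.box_payload_sound hbc (qle (of_decide_eq_true hv)) dt hπ)
  | coneL j k =>
    simp only [StationCert.needD] at hπ
    split at hπ
    · next B l hB hl =>
      split at hπ
      · next hinv =>
        exact finish (c.capCertL l) rfl rfl rfl (hcaps l (List.mem_of_getElem? hl)) (l.box_of_need dt fun r hr => hπ r (List.mem_append_right _ hr))
          (c.payload_sound hinv dt fun r hr => hπ r (List.mem_append_left _ hr))
      · exact absurd hπ (not_nilRow _)
    · exact absurd hπ (not_nilRow _)
  | boxL j k =>
    simp only [StationCert.needD] at hπ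
    split at hπ
    · next b l hb hl =>
      obtain ⟨hbc, -⟩ := Bool.and_eq_true_iff.1 (hboxes b (List.mem_of_getElem? hb))
      have hv : (0 : ℝ) ≤ ((l.capLB * c.u - c.kfac * b.R : ℚ) : ℝ) := by
        simpa [linAt] using hπ _ (List.mem_append_right _ (List.mem_singleton.2 rfl))
      refine finish (c.capCertL l) rfl rfl rfl (hcaps l (List.mem_of_getElem? hl))
        (l.box_of_need dt fun r hr => hπ r (List.mem_append_left _ (List.mem_append_right _ hr)))
        (c.box_payload_sound hbc ?_ dt fun r hr => hπ r (List.mem_append_left _ (List.mem_append_left _ hr)))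
      change ((c.kfac * b.R : ℚ) : ℝ) ≤ ((l.capLB * c.u : ℚ) : ℝ)
      push_cast at hv ⊢
      linarith
    · exact absurd hπ (not_nilRow _)

/-- The shared preamble of the two soundness proofs: slot side conditions and `0 ≤ lo7` from `R.ok` and `0 ≤ loC`. -/
theorem StationCert.diet_prelim (c : StationCert) (hok : c.R.ok = true) (hloC : 0 ≤ c.R.loC) :
    (∀ q, 80 ≤ c.R.lo q ∧ c.R.lo q < c.R.hi q ∧ c.R.hi q ≤ 134) ∧ ∀ o, 0 ≤ c.R.lo7 o := by
  have hok' := hok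
  simp only [StationRowsCert.ok, Bool.and_eq_true, decide_eq_true_eq, List.all_eq_true] at hok'
  have hsl : ∀ q, 80 ≤ c.R.lo q ∧ c.R.lo q < c.R.hi q ∧ c.R.hi q ≤ 134 := fun q => hok'.1.1.2 q (mem_slots6 q)
  refine ⟨hsl, ?_⟩
  rintro (_ | q)
  · exact hloC
  · exact le_trans (by norm_num) (hsl q).1

/-- ★★★ **SOUNDNESS OF THE DIET CHECKER IN THE CHAMBER** — the statement of 112 `sound_chamber` verbatim: `checkD c X = true` ⇒ the (T¹ᶜ) inequality for every
`ρ ∈ [rho0, rho1]` and every chart-realisable positive tuple of the station box lying in the axis-zero chamber (full normal form binders). -/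
theorem StationCert.sound_diet (c : StationCert) (X : DietCert) (h : c.checkD X = true) :
    ∀ ρ : ℝ, (c.R.rho0 : ℝ) ≤ ρ → ρ ≤ c.R.rho1 → ∀ dt : (Fin 3 → ℤ) → ℝ,
      (∀ q, castW c.R.lo q ≤ dt (holeVertex 0 q) ∧ dt (holeVertex 0 q) ≤ castW c.R.hi q) → ((c.R.loC : ℝ) ≤ dt 0 ∧ dt 0 ≤ c.R.hiC) →
      IsChartRealisable ρ dt → (∀ p ∈ stencil 0, 0 < dt p) → poleSum dt 0 ≤ poleSum dt 1 → poleSum dt 0 ≤ poleSum dt 2 →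
      (∀ a : Fin 3, dt (holeVertex 0 (a, true)) ≤ dt (holeVertex 0 (a, false))) →
      feetHoleCost 160 (3 / 100) ρ dt 0 ≤ domCapK c.u 160 (3 / 100) ρ (chargeDepth ρ dt 0) := by
  simp only [StationCert.checkD, Bool.and_eq_true, decide_eq_true_eq, List.all_eq_true] at h
  obtain ⟨⟨⟨⟨⟨⟨hok, hρ0, hloC⟩, hboxes⟩, hcaps⟩, hc0⟩, hX⟩, htree⟩ := h
  intro ρ h₀ h₁ dt hbox hC hreal hpos hch1 hch2 hchp
  have hρ : 0 < ρ := lt_of_lt_of_le (by exact_mod_cast hρ0) h₀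
  have hbox' : ∀ q, (c.R.lo q : ℝ) ≤ dt (holeVertex 0 q) ∧ dt (holeVertex 0 q) ≤ c.R.hi q := fun q => by simpa [castW_apply] using hbox q
  have h7 := c.R.box7 hbox' hC
  obtain ⟨hsl, hnn⟩ := c.diet_prelim hok hloC
  have hrows : ∀ r ∈ c.R.rows ++ chamberRows ++ X.rows, linAt r.a (sval dt) 0 ≤ (r.b : ℝ) := fun r hr => by
    rcases List.mem_append.1 hr with hr | hr
    · rcases List.mem_append.1 hr with hr | hr
      · exact c.R.rows_sound hok h₀ h₁ hbox' hC hreal hpos r hr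
      · exact chamberRows_sound dt hch1 hch2 hchp r hr
    · exact X.rows_sound hX hsl h7 r hr
  obtain ⟨π, hπ⟩ := c.tree.sound_box c.needD c.R.bnd (sval dt) (c.R.bnd_sound h7 hnn) _ htree hrows
  refine c.sound_leaf (fun k => k.capCheck 0 = true) hboxes hcaps hc0 hρ h₁ hbox (fun k e0 e1 eu k0 hb => ?_) hπ
  have hdom := capCheck_zero_chamber k0 hρ (e0 ▸ h₀ :) (e1 ▸ h₁ :) hb hch1 hch2
  rwa [eu] at hdom

/-- ★★★ **SOUNDNESS OF THE DIET CHECKER, FULL FORM** — the statement of 110E `sound` verbatim: `checkDF c X = true` ⇒ the (T¹ᶜ) inequality for every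
`ρ ∈ [rho0, rho1]` and every chart-realisable positive tuple of the station box (the full transverse extent included). -/
theorem StationCert.sound_dietF (c : StationCert) (X : DietCert) (h : c.checkDF X = true) :
    ∀ ρ : ℝ, (c.R.rho0 : ℝ) ≤ ρ → ρ ≤ c.R.rho1 → ∀ dt : (Fin 3 → ℤ) → ℝ,
      (∀ q, castW c.R.lo q ≤ dt (holeVertex 0 q) ∧ dt (holeVertex 0 q) ≤ castW c.R.hi q) → ((c.R.loC : ℝ) ≤ dt 0 ∧ dt 0 ≤ c.R.hiC) →
      IsChartRealisable ρ dt → (∀ p ∈ stencil 0, 0 < dt p) →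
      feetHoleCost 160 (3 / 100) ρ dt 0 ≤ domCapK c.u 160 (3 / 100) ρ (chargeDepth ρ dt 0) := by
  simp only [StationCert.checkDF, Bool.and_eq_true, decide_eq_true_eq, List.all_eq_true] at h
  obtain ⟨⟨⟨⟨⟨⟨⟨⟨hok, hρ0, hloC⟩, hboxes⟩, hcaps⟩, hc0⟩, hc1⟩, hc2⟩, hX⟩, htree⟩ := h
  intro ρ h₀ h₁ dt hbox hC hreal hpos
  have hρ : 0 < ρ := lt_of_lt_of_le (by exact_mod_cast hρ0) h₀
  have hbox' : ∀ q, (c.R.lo q : ℝ) ≤ dt (holeVertex 0 q) ∧ dt (holeVertex 0 q) ≤ c.R.hi q := fun q => by simpa [castW_apply] using hbox q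
  have h7 := c.R.box7 hbox' hC
  obtain ⟨hsl, hnn⟩ := c.diet_prelim hok hloC
  have hrows : ∀ r ∈ c.R.rows ++ X.rows, linAt r.a (sval dt) 0 ≤ (r.b : ℝ) := fun r hr => by
    rcases List.mem_append.1 hr with hr | hr
    · exact c.R.rows_sound hok h₀ h₁ hbox' hC hreal hpos r hr
    · exact X.rows_sound hX hsl h7 r hr
  obtain ⟨π, hπ⟩ := c.tree.sound_box c.needD c.R.bnd (sval dt) (c.R.bnd_sound h7 hnn) _ htree hrows
  have hcapsP : ∀ l ∈ c.caps, (c.capCertL l).capCheck 0 = true ∧ (c.capCertL l).capCheck 1 = true ∧ (c.capCertL l).capCheck 2 = true := fun l hl => by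
    simpa only [StationCert.capCheckL, Bool.and_eq_true, and_assoc] using hcaps l hl
  refine c.sound_leaf (fun k => k.capCheck 0 = true ∧ k.capCheck 1 = true ∧ k.capCheck 2 = true) hboxes hcapsP ⟨hc0, hc1, hc2⟩ hρ h₁ hbox
    (fun k e0 e1 eu hk hb => ?_) hπ
  have hcap : ∀ a : Fin 3, k.capCheck a = true := fun a => by
    fin_cases a
    exacts [hk.1, hk.2.1, hk.2.2]
  have hdom := cap_at_chargeDepth (ϱ := 160) (τ := 3 / 100) hρ (e0 ▸ h₀ :) (e1 ▸ h₁ :) (fun a => k.capCheck_sound a (hcap a)) dt hb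
  rwa [eu] at hdom

/-- ★ Batch form (chamber) over `(station, diet)` pairs — the shape the cover theorem (door D4) consumes. -/
theorem StationCert.sound_diet_of_all {cs : List (StationCert × DietCert)} (h : cs.all (fun p => p.1.checkD p.2) = true) {p : StationCert × DietCert}
    (hp : p ∈ cs) :
    ∀ ρ : ℝ, (p.1.R.rho0 : ℝ) ≤ ρ → ρ ≤ p.1.R.rho1 → ∀ dt : (Fin 3 → ℤ) → ℝ,
      (∀ q, castW p.1.R.lo q ≤ dt (holeVertex 0 q) ∧ dt (holeVertex 0 q) ≤ castW p.1.R.hi q) → ((p.1.R.loC : ℝ) ≤ dt 0 ∧ dt 0 ≤ p.1.R.hiC) →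
      IsChartRealisable ρ dt → (∀ p ∈ stencil 0, 0 < dt p) → poleSum dt 0 ≤ poleSum dt 1 → poleSum dt 0 ≤ poleSum dt 2 →
      (∀ a : Fin 3, dt (holeVertex 0 (a, true)) ≤ dt (holeVertex 0 (a, false))) →
      feetHoleCost 160 (3 / 100) ρ dt 0 ≤ domCapK p.1.u 160 (3 / 100) ρ (chargeDepth ρ dt 0) :=
  p.1.sound_diet p.2 (List.all_eq_true.mp h p hp)
end Summit.AtomisticToContinuum.Crystallization.Theorems.ChargedEnergyGapChartDial
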